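import Summits.BirchSwinnertonDyer.Rank1Residual.Additive.TameBranchTwoValueLaw
import Summits.BirchSwinnertonDyer.Rank1Residual.Additive.TameBranchOneValueCertificateJoin
import HarnessLib

/-!
# TWO VALUES PER PAIR, EVERY KODAIRA TYPE: the two-value certificate fed into `CharLamLeAt` and the
# sign decided from the same two values (witness currency) — Delbourgo 1998 Thm 1 + 2002 (A)(C) +
# TWO exact `p`-adic valuations, with NO unit root, NO sign certificate, NO Riemann sum, NO
# Kodaira-type input (cell `b2b-bsdres`, sub-cell additive-p2 = X3♯(G-ord)/X4♯(G-ord), gen 28;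
# part 2/4)

HONEST FRAMING (cell `b2b-bsdres`, run/shared/lean/b2b/bsd-rank1-residual/, verbatim in every
file): the goal of the cell is to DELETE the COMBINATION-SHAPED residual classes of the
Birch–Swinnerton-Dyer formula for ALL analytic-rank `≤ 1` elliptic curves over `ℚ` — "full BSD
formula for every rank `≤ 1` curve in class `C`" assembled STRICTLY from published theorems — so
that the rank-`≤ 1` remainder becomes exactly the CONSTRUCTION-SHAPED classes, which are TYPED
(missing-input `Prop`s), NOT attempted. This is not "finishing BSD". Sub-cell additive-p2: the
classes X3♯(G-ord) / X4♯(G-ord) are CONSTRUCTION-SHAPED and stay so; labels / RESIDUAL-MAP marks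
UNCHANGED; nothing is booked. Theorems only; the named facts enter as hypothesis binders
(`Delbourgo1998.thm1_exists_bounded_evenMeasure` A282, `Delbourgo2002.mainTheorem` A175,
`Delbourgo2002.thmC_charIdeal_dvd_tameBranch` A227, `Delbourgo2002.mainTheorem_potMult`).
No definition, no `sorry`.

## What

Gen 27 (`TameBranchOneValueCertificateJoin.lean` §7–§8): on the UNSTARRED rows ONE value
`‖S(κ)‖^{e·φ} = (p^c)^{e·φ}·p^{−(e·k+φ)}` (`e·k < (e−2)φ`) gives `CharLamLeAt W p k` and, at rank one,
Schneider; on STARRED rows the sign still came from gen 25's sign certificate (§9). Part 1 of this gen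
(`TameBranchTwoValueLaw.lean`) showed why one starred value cannot decide and that the NEXT conductor
does. Here, with `χ = ω^u` the Teichmüller power of the SMALL exponent (`eu = p − 1`, a finite check on
`χ`; no claim about `E`) and the plus-symbol tower bound `p^c`:

* §5 **STARRED, TWO LEVELS** (`charLamLeAt_of_thm1_of_thmC_of_norm_ratTwistedSymbolSum_inv_succ`): two
  even primitive `p`-power-order characters `κ`, `κ'` of conductors `p^{n+1+e₀}`, `p^{n+2+e₀}` whose
  twisted symbol sums lie on the STARRED line with the same `k`,
  **`‖S(κ)‖^{e·φₙ} = (p^c)^{e·φₙ}·p^{−(e·k+(e−1)φₙ)}`**, **`‖S(κ')‖^{e·φₙ₊₁} = (p^c)^{e·φₙ₊₁}·p^{−(e·k+(e−1)φₙ₊₁)}`**,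
  `e·k < 2φₙ` ⟹ `CharLamLeAt W p k`. Mechanism: Delbourgo 1998 Thm 1 gives a bounded branch for
  `(χ₀, ã₀)`, `χ₀ ∈ {χ, χ⁻¹}`; `χ₀ = χ` is refuted by the two levels (part 1 §4); `χ₀ = χ⁻¹` reads
  `‖[T^k]B‖ = p^c` by the inverse-form certificate and Delbourgo 2002 (C) bounds `λ`.
* §5 **TYPE-FREE** (`charLamLeAt_of_thm1_of_thmC_of_two_norm_ratTwistedSymbolSum`): the two values lie on
  ONE of the two lines, `t ∈ {1, e−1}`: `‖S(κ)‖^{e·φₙ} = (p^c)^{e·φₙ}·p^{−(e·k+t·φₙ)}` and the same at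
  level `n+1`, `e·k < 2φₙ` ⟹ `CharLamLeAt W p k` — whichever Kodaira type, whichever sign.
* §6 **THE SIGN FROM THE SAME TWO VALUES** (witness currency): FACT-FREE
  (`not_exists_isTameBranchOf_of_norm_ratTwistedSymbolSum_inv_succ`: no witness of `(ι∘χ, α)`,
  `‖α‖ = 1`, with coefficients bounded by `p^c` exists) and with Delbourgo 1998 Thm 1
  (`exists_isTameBranchOf_inv_firstTop_of_thm1_…`: a witness of `(ι∘χ⁻¹, ã₀)` with first top at `k`
  EXISTS — Delbourgo's `ε = ω^{(e−1)u}` and `λ_an = k` read from `E`'s plus symbols); the unstarred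
  companion from ONE value (`exists_isTameBranchOf_firstTop_of_thm1_of_norm_ratTwistedSymbolSum`).
  Part 3 (`TameBranchTwoValueRankOne.lean`): the forced-partner currency (THE STARRED SIGN
  CERTIFICATE), Schneider at rank one and the class forms on X4♯(G-ord)/X3♯(G-ord); part 4 the
  character-free forms.

EVIDENCE (not an input; HOME/b2b-bsdres-additive-p2/gen28/TWO-VALUE-READING.md, zero compute from
gen 26's E-GAUSSCERT (p²) + E-GAUSSCERT3 (p³)): the five STARRED Gord_e346 window rows carry the two
values on the starred line with a common `k` and `e·k < 2(p−1)`: 10725e1, 11550n1, 11825i1 @5 (III*,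
`k = 1`: `(1, 4/5)`), 19110bm1@7 (IV*, `k = 1`: `(5/6, 29/42)`), 11760bb1@7 (IV*, `k = 3`:
`(7/6, 31/42)`); and the unstarred III row 175a1@5 (`λ_an = 3`) shares its `p²` value `1` with the
III* rows — one value is genuinely ambiguous there, the `p³` values (`2/5` vs `4/5`) separate them.

Not claimed: `μ`; the LOWER half; which Teichmüller power is bounded on which Kodaira type; any booking.

References: Delbourgo 1998 Thm. 1 [Delbourgo1998]; Delbourgo 2002 Thm. (A)(B)(C) [Delbourgo2002]; Lang
Ch. 1 §2 Thm. 2.1 [Lang1990]; MTT 1986 §I.8, §I.13–I.14 [MazurTateTeitelbaum1986Invent]. -/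

set_option autoImplicit false

noncomputable section

open scoped Classical MatrixGroups ModularForm NumberField

open CongruenceSubgroup IsDedekindDomain WeierstrassCurve NumberField
  Literature.NumberTheory.EllipticCurves
  Literature.NumberTheory.EllipticCurves.ModularForms
  Literature.NumberTheory.EllipticCurves.Rank1Residual
  Literature.NumberTheory.EllipticCurves.Rank1Residual.Typed
  Literature.NumberTheory.EllipticCurves.Delbourgo2002
  Summit.BirchSwinnertonDyer.Rank1Residual.X1.MuLambda
  Summit.BirchSwinnertonDyer.Rank1Residual.X11a.LambdaNorm

namespace Summit.BirchSwinnertonDyer.Rank1Residual.Additive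

namespace TwistPartner

open TameBranchOneValue TameBranchTwoValue

/-! ### §5 `CharLamLeAt` from print and TWO VALUES — starred rows, then type-free -/

section TwoValues

variable {W : WeierstrassCurve ℚ} [W.IsElliptic] [W.IsGloballyMinimal] {p : ℕ} [hp : Fact p.Prime]
  {N : ℕ} [NeZero N] {f : CuspForm (Gamma0 N) 2} {χ : MulChar (ZMod p) ℚ_[p]}

/-- `3 ≤ e` for `e ∈ {3,4,6}`. [folklore] -/
theorem three_le_of_mem {e : ℕ} (he : e ∈ ({3, 4, 6} : Finset ℕ)) : 3 ≤ e := by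
  simp only [Finset.mem_insert, Finset.mem_singleton] at he; omega

/-- **`CharLamLeAt W p k` FROM PRINT AND TWO VALUES — STARRED LINE.** `p ≥ 5`, `E = W` non-CM,
ADDITIVE, (G)-ordinary, `e = semistabilityIndex W p ∈ {3,4,6}`, newform `f`; `χ` the Teichmüller power
of the SMALL exponent `u` of order `e` (`eu = p − 1`); a tower bound `‖[a/p^m]⁺_f‖_p ≤ p^c`; TWO even
primitive `p`-power-order characters `κ` (conductor `p^{n+1+e₀}`) and `κ'` (conductor `p^{n+2+e₀}`) with
**`‖S(κ)‖^{e·φₙ} = (p^c)^{e·φₙ}·p^{−(e·k+(e−1)φₙ)}`**, **`‖S(κ')‖^{e·φₙ₊₁} = (p^c)^{e·φₙ₊₁}·p^{−(e·k+(e−1)φₙ₊₁)}`**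
(`φₘ = φ(p^{m+1})`) and **`e·k < 2φₙ`**. Then `CharLamLeAt W p k`. Mechanism: Delbourgo 1998 Thm 1 gives
a bounded branch `B` for `(χ₀, ã₀)`, `χ₀ ∈ {χ, χ⁻¹}`; `χ₀ = χ` would put the first top coefficient of
`B` at `k + (e−2)u·pⁿ` AND at `k + (e−2)u·pⁿ⁺¹` (part 1); so `χ₀ = χ⁻¹`, the inverse-form certificate
reads `‖[T^k]B‖ = p^c`, and Delbourgo 2002 (C) bounds `λ`. NO (G)-field, unit root, forced partner,
sign certificate or Riemann sum. Nothing booked. [cite: Delbourgo1998, Theorem 1 (p. 131)]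
[cite: Delbourgo2002, Theorem (A), (C) (p. 40)] [cite: Lang1990, Ch. 1 §2 Thm. 2.1]
[cite: MazurTateTeitelbaum1986Invent, §I.8, §I.13–I.14] -/
theorem charLamLeAt_of_thm1_of_thmC_of_norm_ratTwistedSymbolSum_inv_succ
    (hD : Delbourgo1998.thm1_exists_bounded_evenMeasure)
    (hC : Delbourgo2002.thmC_charIdeal_dvd_tameBranch) (hDel : Delbourgo2002.mainTheorem)
    (hDelM : Delbourgo2002.mainTheorem_potMult) (h5 : 5 ≤ p) (hcm : ¬ W.HasCM) (hadd : Addv W p)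
    (hGord : TypeGOrd W p) (he : semistabilityIndex W p ∈ ({3, 4, 6} : Finset ℕ))
    (hf : IsNewformOf W f) (hχe : orderOf χ = semistabilityIndex W p) {u : ℕ}
    (hu : semistabilityIndex W p * u = p - 1)
    (hteich : ∀ a : ZMod p, a ≠ 0 → ‖χ a - ((a.val : ℕ) : ℚ_[p]) ^ u‖ < 1) {c : ℕ}
    (hc : ∀ (m : ℕ) (a : ℤ), ‖((ratPlusSymbol f ((a : ℚ) / (p : ℚ) ^ m) : ℚ) : ℚ_[p])‖ ≤ (p : ℝ) ^ c)
    {n : ℕ} {κ : DirichletCharacter ℂ_[p] (p ^ (n + 1 + cyclotomicExponent p))} (hκ : κ.IsPrimitive)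
    (heven : κ.Even) (hord : ∃ j : ℕ, orderOf κ = p ^ j)
    {κ' : DirichletCharacter ℂ_[p] (p ^ (n + 1 + 1 + cyclotomicExponent p))} (hκ' : κ'.IsPrimitive)
    (heven' : κ'.Even) (hord' : ∃ j : ℕ, orderOf κ' = p ^ j) {k : ℕ}
    (hk2 : semistabilityIndex W p * k < 2 * Nat.totient (p ^ (n + 1)))
    (hval : ‖ratTwistedSymbolSum f κ‖ ^ (semistabilityIndex W p * Nat.totient (p ^ (n + 1))) =
      ((p : ℝ) ^ c) ^ (semistabilityIndex W p * Nat.totient (p ^ (n + 1))) *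
        ((p : ℝ)⁻¹) ^ (semistabilityIndex W p * k +
          (semistabilityIndex W p - 1) * Nat.totient (p ^ (n + 1))))
    (hval' : ‖ratTwistedSymbolSum f κ'‖ ^ (semistabilityIndex W p * Nat.totient (p ^ (n + 1 + 1))) =
      ((p : ℝ) ^ c) ^ (semistabilityIndex W p * Nat.totient (p ^ (n + 1 + 1))) *
        ((p : ℝ)⁻¹) ^ (semistabilityIndex W p * k +
          (semistabilityIndex W p - 1) * Nat.totient (p ^ (n + 1 + 1)))) :
    CharLamLeAt W p k := by
  have hp2 : p ≠ 2 := by omega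
  have h3 : 3 ≤ semistabilityIndex W p := three_le_of_mem he
  have h2 : 2 ≤ semistabilityIndex W p := by omega
  have hG : SubGord W p := (subGord_iff_typeG_of_addv W p hp2 hadd).mpr hGord.typeG
  have hT : TameBranchRatDvdAt W p := tameBranchRatDvdAt_of_thmC hC hDel hDelM h5 hcm
  obtain ⟨χ₀, ã₀, B, hord0, hã₀, hB, hint⟩ := exists_isTameBranchOf_of_thm1 hD h5 hadd hGord he hf
  have hbd : ∀ j : ℕ, ‖PowerSeries.coeff j B‖ ≤ (p : ℝ) ^ c := hint _ hc
  have hkφ : k < Nat.totient (p ^ (n + 1)) := lt_of_mul_lt_two_mul h2 hk2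
  have hord0' : orderOf χ₀ = semistabilityIndex W p := by
    have h := hord0
    rwa [orderOf_ringHomComp_padicComplex, tameDefect_of_not_potMult W p hG.1] at h
  rcases eq_or_eq_inv_of_orderOf_eq he hχe hord0' with h0 | h0
  · exfalso
    subst h0
    exact hB.false_of_norm_ratTwistedSymbolSum_pow_eq_succ hã₀ hbd hteich hχe h3 hu hκ heven hord hκ'
      heven' hord' hk2 hval hval'
  · subst h0
    have hk := (hB.firstTop_of_norm_ratTwistedSymbolSum_pow_eq_inv hã₀ hbd hteich hχe h2 hu hκ heven
      hord hkφ hval).1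
    exact charLamLeAt_of_tameBranchRatDvdAt_of_norm_le_pow_of_norm_coeff_eq_pow hT hp2 hadd
      (Or.inr hGord) hf hord0 hã₀ hB hbd hk

/-- **`CharLamLeAt W p k` FROM PRINT AND TWO VALUES — TYPE-FREE.** Same setting (`p ≥ 5`, non-CM,
ADDITIVE, (G)-ordinary, `e ∈ {3,4,6}`, `χ = ω^u`, tower bound `p^c`, `κ`, `κ'` at consecutive conductors,
`e·k < 2φₙ`); the two values lie on ONE of the two lines, **`t ∈ {1, e−1}`**:
**`‖S(κ)‖^{e·φₙ} = (p^c)^{e·φₙ}·p^{−(e·k+t·φₙ)}`** and **`‖S(κ')‖^{e·φₙ₊₁} = (p^c)^{e·φₙ₊₁}·p^{−(e·k+t·φₙ₊₁)}`**.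
Then `CharLamLeAt W p k` — whichever Kodaira type, whichever sign: on the `t = 1` line the level-`n`
value certifies (`χ₀ = χ`) or the level-`n+1` value refutes (`χ₀ = χ⁻¹`: Gauss bound, `e·k < (e−2)φₙ₊₁`
being automatic); on the `t = e−1` line the previous theorem. Nothing booked.
[cite: Delbourgo1998, Theorem 1 (p. 131)] [cite: Delbourgo2002, Theorem (A), (C) (p. 40)]
[cite: Lang1990, Ch. 1 §2 Thm. 2.1] [cite: MazurTateTeitelbaum1986Invent, §I.8, §I.13–I.14] -/
theorem charLamLeAt_of_thm1_of_thmC_of_two_norm_ratTwistedSymbolSum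
    (hD : Delbourgo1998.thm1_exists_bounded_evenMeasure)
    (hC : Delbourgo2002.thmC_charIdeal_dvd_tameBranch) (hDel : Delbourgo2002.mainTheorem)
    (hDelM : Delbourgo2002.mainTheorem_potMult) (h5 : 5 ≤ p) (hcm : ¬ W.HasCM) (hadd : Addv W p)
    (hGord : TypeGOrd W p) (he : semistabilityIndex W p ∈ ({3, 4, 6} : Finset ℕ))
    (hf : IsNewformOf W f) (hχe : orderOf χ = semistabilityIndex W p) {u : ℕ}
    (hu : semistabilityIndex W p * u = p - 1)
    (hteich : ∀ a : ZMod p, a ≠ 0 → ‖χ a - ((a.val : ℕ) : ℚ_[p]) ^ u‖ < 1) {c : ℕ}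
    (hc : ∀ (m : ℕ) (a : ℤ), ‖((ratPlusSymbol f ((a : ℚ) / (p : ℚ) ^ m) : ℚ) : ℚ_[p])‖ ≤ (p : ℝ) ^ c)
    {n : ℕ} {κ : DirichletCharacter ℂ_[p] (p ^ (n + 1 + cyclotomicExponent p))} (hκ : κ.IsPrimitive)
    (heven : κ.Even) (hord : ∃ j : ℕ, orderOf κ = p ^ j)
    {κ' : DirichletCharacter ℂ_[p] (p ^ (n + 1 + 1 + cyclotomicExponent p))} (hκ' : κ'.IsPrimitive)
    (heven' : κ'.Even) (hord' : ∃ j : ℕ, orderOf κ' = p ^ j) {k t : ℕ}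
    (ht : t = 1 ∨ t = semistabilityIndex W p - 1)
    (hk2 : semistabilityIndex W p * k < 2 * Nat.totient (p ^ (n + 1)))
    (hval : ‖ratTwistedSymbolSum f κ‖ ^ (semistabilityIndex W p * Nat.totient (p ^ (n + 1))) =
      ((p : ℝ) ^ c) ^ (semistabilityIndex W p * Nat.totient (p ^ (n + 1))) *
        ((p : ℝ)⁻¹) ^ (semistabilityIndex W p * k + t * Nat.totient (p ^ (n + 1))))
    (hval' : ‖ratTwistedSymbolSum f κ'‖ ^ (semistabilityIndex W p * Nat.totient (p ^ (n + 1 + 1))) =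
      ((p : ℝ) ^ c) ^ (semistabilityIndex W p * Nat.totient (p ^ (n + 1 + 1))) *
        ((p : ℝ)⁻¹) ^ (semistabilityIndex W p * k + t * Nat.totient (p ^ (n + 1 + 1)))) :
    CharLamLeAt W p k := by
  rcases ht with rfl | rfl
  · -- the unstarred line
    rw [one_mul] at hval hval'
    have hp2 : p ≠ 2 := by omega
    have h3 : 3 ≤ semistabilityIndex W p := three_le_of_mem he
    have h2 : 2 ≤ semistabilityIndex W p := by omega
    have hG : SubGord W p := (subGord_iff_typeG_of_addv W p hp2 hadd).mpr hGord.typeG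
    have hT : TameBranchRatDvdAt W p := tameBranchRatDvdAt_of_thmC hC hDel hDelM h5 hcm
    obtain ⟨χ₀, ã₀, B, hord0, hã₀, hB, hint⟩ := exists_isTameBranchOf_of_thm1 hD h5 hadd hGord he hf
    have hbd : ∀ j : ℕ, ‖PowerSeries.coeff j B‖ ≤ (p : ℝ) ^ c := hint _ hc
    have hkφ : k < Nat.totient (p ^ (n + 1)) := lt_of_mul_lt_two_mul h2 hk2
    have hord0' : orderOf χ₀ = semistabilityIndex W p := by
      have h := hord0
      rwa [orderOf_ringHomComp_padicComplex, tameDefect_of_not_potMult W p hG.1] at h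
    rcases eq_or_eq_inv_of_orderOf_eq he hχe hord0' with h0 | h0
    · subst h0
      have hk := (hB.firstTop_of_norm_ratTwistedSymbolSum_pow_eq hã₀ hbd hteich hχe h2 hu hκ heven hord
        hkφ hval).1
      exact charLamLeAt_of_tameBranchRatDvdAt_of_norm_le_pow_of_norm_coeff_eq_pow hT hp2 hadd
        (Or.inr hGord) hf hord0 hã₀ hB hbd hk
    · exfalso
      subst h0
      exact hB.false_of_norm_ratTwistedSymbolSum_pow_eq_inv_succ hã₀ hbd hteich hχe h3 hu hκ' heven'
        hord' hk2 hval'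
  · -- the starred line
    exact charLamLeAt_of_thm1_of_thmC_of_norm_ratTwistedSymbolSum_inv_succ hD hC hDel hDelM h5 hcm hadd
      hGord he hf hχe hu hteich hc hκ heven hord hκ' heven' hord' hk2 hval hval'

/-! ### §6 The sign from the same two values -/

omit [NeZero N] in
/-- **NO UNSTARRED WITNESS (fact-free).** `χ = ω^u` (small exponent, order `e ≥ 3`, `eu = p − 1`): if
two even primitive `p`-power-order characters at consecutive conductors `p^{n+1+e₀}`, `p^{n+2+e₀}` have
their twisted symbol sums on the STARRED line with the same `k`, `e·k < 2φₙ`, then NO tuple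
`(ι∘χ, α, B)` with `‖α‖ = 1` and coefficients bounded by `p^c` satisfies the interpolation package —
the sign bit in cc-typer-2's witness currency, from `E`'s plus symbols alone (part 1 §4).
[cite: Lang1990, Ch. 1 §2 Thm. 2.1] [cite: MazurTateTeitelbaum1986Invent, §I.8, §I.13–I.14] -/
theorem not_exists_isTameBranchOf_of_norm_ratTwistedSymbolSum_inv_succ {u e : ℕ}
    (hteich : ∀ a : ZMod p, a ≠ 0 → ‖χ a - ((a.val : ℕ) : ℚ_[p]) ^ u‖ < 1)
    (hχe : orderOf χ = e) (h3 : 3 ≤ e) (hu : e * u = p - 1) (c : ℕ)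
    {n : ℕ} {κ : DirichletCharacter ℂ_[p] (p ^ (n + 1 + cyclotomicExponent p))} (hκ : κ.IsPrimitive)
    (heven : κ.Even) (hord : ∃ j : ℕ, orderOf κ = p ^ j)
    {κ' : DirichletCharacter ℂ_[p] (p ^ (n + 1 + 1 + cyclotomicExponent p))} (hκ' : κ'.IsPrimitive)
    (heven' : κ'.Even) (hord' : ∃ j : ℕ, orderOf κ' = p ^ j) {k : ℕ}
    (hk2 : e * k < 2 * Nat.totient (p ^ (n + 1)))
    (hval : ‖ratTwistedSymbolSum f κ‖ ^ (e * Nat.totient (p ^ (n + 1))) =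
      ((p : ℝ) ^ c) ^ (e * Nat.totient (p ^ (n + 1))) *
        ((p : ℝ)⁻¹) ^ (e * k + (e - 1) * Nat.totient (p ^ (n + 1))))
    (hval' : ‖ratTwistedSymbolSum f κ'‖ ^ (e * Nat.totient (p ^ (n + 1 + 1))) =
      ((p : ℝ) ^ c) ^ (e * Nat.totient (p ^ (n + 1 + 1))) *
        ((p : ℝ)⁻¹) ^ (e * k + (e - 1) * Nat.totient (p ^ (n + 1 + 1)))) :
    ¬ ∃ (α : ℚ_[p]) (B : PowerSeries ℚ_[p]), ‖α‖ = 1 ∧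
      IsTameBranchOf f p (χ.ringHomComp (algebraMap ℚ_[p] ℂ_[p])) α B ∧
      ∀ j : ℕ, ‖PowerSeries.coeff j B‖ ≤ (p : ℝ) ^ c := by
  rintro ⟨α, B, hα, hB, hbd⟩
  exact hB.false_of_norm_ratTwistedSymbolSum_pow_eq_succ hα hbd hteich hχe h3 hu hκ heven hord hκ'
    heven' hord' hk2 hval hval'

/-- **THE STARRED WITNESS EXISTS AND HAS `λ_an = k` (Delbourgo 1998 Thm 1 + two values).** `p ≥ 5`,
ADDITIVE, (G)-ordinary, `e ∈ {3,4,6}`, newform `f`, `χ = ω^u` of order `e`, tower bound `p^c`, and two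
values on the STARRED line at consecutive conductors with `e·k < 2φₙ`: then there are `ã₀` with
`‖ã₀‖ = 1` and `B` with `IsTameBranchOf f p (ι∘χ⁻¹) ã₀ B`, every tower bound of the plus symbols
inherited by `B`, and FIRST top coefficient at `k` (`‖[T^k]B‖ = p^c`, earlier ones `< p^c`) — Delbourgo's
`ε = χ⁻¹ = ω^{(e−1)u}` and `λ_an = k` READ from `E`'s plus symbols; no unit root, field, forced partner or
sign certificate supplied. Nothing booked. [cite: Delbourgo1998, Theorem 1 (p. 131)]
[cite: Lang1990, Ch. 1 §2 Thm. 2.1] [cite: MazurTateTeitelbaum1986Invent, §I.8, §I.13–I.14] -/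
theorem exists_isTameBranchOf_inv_firstTop_of_thm1_of_norm_ratTwistedSymbolSum_inv_succ
    (hD : Delbourgo1998.thm1_exists_bounded_evenMeasure) (h5 : 5 ≤ p) (hadd : Addv W p)
    (hGord : TypeGOrd W p) (he : semistabilityIndex W p ∈ ({3, 4, 6} : Finset ℕ))
    (hf : IsNewformOf W f) (hχe : orderOf χ = semistabilityIndex W p) {u : ℕ}
    (hu : semistabilityIndex W p * u = p - 1)
    (hteich : ∀ a : ZMod p, a ≠ 0 → ‖χ a - ((a.val : ℕ) : ℚ_[p]) ^ u‖ < 1) {c : ℕ}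
    (hc : ∀ (m : ℕ) (a : ℤ), ‖((ratPlusSymbol f ((a : ℚ) / (p : ℚ) ^ m) : ℚ) : ℚ_[p])‖ ≤ (p : ℝ) ^ c)
    {n : ℕ} {κ : DirichletCharacter ℂ_[p] (p ^ (n + 1 + cyclotomicExponent p))} (hκ : κ.IsPrimitive)
    (heven : κ.Even) (hord : ∃ j : ℕ, orderOf κ = p ^ j)
    {κ' : DirichletCharacter ℂ_[p] (p ^ (n + 1 + 1 + cyclotomicExponent p))} (hκ' : κ'.IsPrimitive)
    (heven' : κ'.Even) (hord' : ∃ j : ℕ, orderOf κ' = p ^ j) {k : ℕ}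
    (hk2 : semistabilityIndex W p * k < 2 * Nat.totient (p ^ (n + 1)))
    (hval : ‖ratTwistedSymbolSum f κ‖ ^ (semistabilityIndex W p * Nat.totient (p ^ (n + 1))) =
      ((p : ℝ) ^ c) ^ (semistabilityIndex W p * Nat.totient (p ^ (n + 1))) *
        ((p : ℝ)⁻¹) ^ (semistabilityIndex W p * k +
          (semistabilityIndex W p - 1) * Nat.totient (p ^ (n + 1))))
    (hval' : ‖ratTwistedSymbolSum f κ'‖ ^ (semistabilityIndex W p * Nat.totient (p ^ (n + 1 + 1))) =
      ((p : ℝ) ^ c) ^ (semistabilityIndex W p * Nat.totient (p ^ (n + 1 + 1))) *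
        ((p : ℝ)⁻¹) ^ (semistabilityIndex W p * k +
          (semistabilityIndex W p - 1) * Nat.totient (p ^ (n + 1 + 1)))) :
    ∃ (ã₀ : ℚ_[p]) (B : PowerSeries ℚ_[p]), ‖ã₀‖ = 1 ∧
      IsTameBranchOf f p (χ⁻¹.ringHomComp (algebraMap ℚ_[p] ℂ_[p])) ã₀ B ∧
      (∀ C : ℝ, (∀ (m : ℕ) (a : ℤ), ‖((ratPlusSymbol f ((a : ℚ) / (p : ℚ) ^ m) : ℚ) : ℚ_[p])‖ ≤ C) →
        ∀ j : ℕ, ‖PowerSeries.coeff j B‖ ≤ C) ∧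
      ‖PowerSeries.coeff k B‖ = (p : ℝ) ^ c ∧ ∀ i < k, ‖PowerSeries.coeff i B‖ < (p : ℝ) ^ c := by
  have hp2 : p ≠ 2 := by omega
  have h3 : 3 ≤ semistabilityIndex W p := three_le_of_mem he
  have h2 : 2 ≤ semistabilityIndex W p := by omega
  have hG : SubGord W p := (subGord_iff_typeG_of_addv W p hp2 hadd).mpr hGord.typeG
  obtain ⟨χ₀, ã₀, B, hord0, hã₀, hB, hint⟩ := exists_isTameBranchOf_of_thm1 hD h5 hadd hGord he hf
  have hbd : ∀ j : ℕ, ‖PowerSeries.coeff j B‖ ≤ (p : ℝ) ^ c := hint _ hc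
  have hkφ : k < Nat.totient (p ^ (n + 1)) := lt_of_mul_lt_two_mul h2 hk2
  have hord0' : orderOf χ₀ = semistabilityIndex W p := by
    have h := hord0
    rwa [orderOf_ringHomComp_padicComplex, tameDefect_of_not_potMult W p hG.1] at h
  rcases eq_or_eq_inv_of_orderOf_eq he hχe hord0' with h0 | h0
  · exfalso
    subst h0
    exact hB.false_of_norm_ratTwistedSymbolSum_pow_eq_succ hã₀ hbd hteich hχe h3 hu hκ heven hord hκ'
      heven' hord' hk2 hval hval'
  · subst h0
    exact ⟨ã₀, B, hã₀, hB, hint, hB.firstTop_of_norm_ratTwistedSymbolSum_pow_eq_inv hã₀ hbd hteich hχe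
      h2 hu hκ heven hord hkφ hval⟩

/-- **THE UNSTARRED WITNESS EXISTS AND HAS `λ_an = k` (Delbourgo 1998 Thm 1 + ONE value)** — the
companion of gen 27's `charLamLeAt_of_thm1_of_thmC_of_norm_ratTwistedSymbolSum` in witness currency:
`χ = ω^u`, tower bound `p^c`, ONE `κ` of conductor `p^{n+1+e₀}` with `‖S(κ)‖^{e·φ} = (p^c)^{e·φ}·p^{−(e·k+φ)}`,
`e·k < (e−2)φ` ⟹ there are `ã₀` (`‖ã₀‖ = 1`) and `B` with `IsTameBranchOf f p (ι∘χ) ã₀ B`, the tower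
bounds inherited, and first top coefficient at `k`. Nothing booked. [cite: Delbourgo1998, Theorem 1 (p. 131)]
[cite: Lang1990, Ch. 1 §2 Thm. 2.1] [cite: MazurTateTeitelbaum1986Invent, §I.8, §I.13–I.14] -/
theorem exists_isTameBranchOf_firstTop_of_thm1_of_norm_ratTwistedSymbolSum
    (hD : Delbourgo1998.thm1_exists_bounded_evenMeasure) (h5 : 5 ≤ p) (hadd : Addv W p)
    (hGord : TypeGOrd W p) (he : semistabilityIndex W p ∈ ({3, 4, 6} : Finset ℕ))
    (hf : IsNewformOf W f) (hχe : orderOf χ = semistabilityIndex W p) {u : ℕ}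
    (hu : semistabilityIndex W p * u = p - 1)
    (hteich : ∀ a : ZMod p, a ≠ 0 → ‖χ a - ((a.val : ℕ) : ℚ_[p]) ^ u‖ < 1) {c : ℕ}
    (hc : ∀ (m : ℕ) (a : ℤ), ‖((ratPlusSymbol f ((a : ℚ) / (p : ℚ) ^ m) : ℚ) : ℚ_[p])‖ ≤ (p : ℝ) ^ c)
    {n : ℕ} {κ : DirichletCharacter ℂ_[p] (p ^ (n + 1 + cyclotomicExponent p))} (hκ : κ.IsPrimitive)
    (heven : κ.Even) (hord : ∃ j : ℕ, orderOf κ = p ^ j) {k : ℕ}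
    (hke : semistabilityIndex W p * k < (semistabilityIndex W p - 2) * Nat.totient (p ^ (n + 1)))
    (hval : ‖ratTwistedSymbolSum f κ‖ ^ (semistabilityIndex W p * Nat.totient (p ^ (n + 1))) =
      ((p : ℝ) ^ c) ^ (semistabilityIndex W p * Nat.totient (p ^ (n + 1))) *
        ((p : ℝ)⁻¹) ^ (semistabilityIndex W p * k + Nat.totient (p ^ (n + 1)))) :
    ∃ (ã₀ : ℚ_[p]) (B : PowerSeries ℚ_[p]), ‖ã₀‖ = 1 ∧
      IsTameBranchOf f p (χ.ringHomComp (algebraMap ℚ_[p] ℂ_[p])) ã₀ B ∧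
      (∀ C : ℝ, (∀ (m : ℕ) (a : ℤ), ‖((ratPlusSymbol f ((a : ℚ) / (p : ℚ) ^ m) : ℚ) : ℚ_[p])‖ ≤ C) →
        ∀ j : ℕ, ‖PowerSeries.coeff j B‖ ≤ C) ∧
      ‖PowerSeries.coeff k B‖ = (p : ℝ) ^ c ∧ ∀ i < k, ‖PowerSeries.coeff i B‖ < (p : ℝ) ^ c := by
  have hp2 : p ≠ 2 := by omega
  have h2 : 2 ≤ semistabilityIndex W p := by have := three_le_of_mem he; omega
  have hG : SubGord W p := (subGord_iff_typeG_of_addv W p hp2 hadd).mpr hGord.typeG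
  obtain ⟨χ₀, ã₀, B, hord0, hã₀, hB, hint⟩ := exists_isTameBranchOf_of_thm1 hD h5 hadd hGord he hf
  have hbd : ∀ j : ℕ, ‖PowerSeries.coeff j B‖ ≤ (p : ℝ) ^ c := hint _ hc
  have hkφ : k < Nat.totient (p ^ (n + 1)) := lt_of_mul_lt_sub_two_mul hke
  have hord0' : orderOf χ₀ = semistabilityIndex W p := by
    have h := hord0
    rwa [orderOf_ringHomComp_padicComplex, tameDefect_of_not_potMult W p hG.1] at h
  rcases eq_or_eq_inv_of_orderOf_eq he hχe hord0' with h0 | h0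
  · subst h0
    exact ⟨ã₀, B, hã₀, hB, hint, hB.firstTop_of_norm_ratTwistedSymbolSum_pow_eq hã₀ hbd hteich hχe h2 hu
      hκ heven hord hkφ hval⟩
  · exfalso
    subst h0
    exact hB.false_of_norm_ratTwistedSymbolSum_pow_eq_inv hã₀ hbd hteich hχe h2 hu hκ heven hord hke
      hval

end TwoValues

end TwistPartner

end Summit.BirchSwinnertonDyer.Rank1Residual.Additive

end
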